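import Literature.Barriers.ValiantsHypothesis.BDGIL24WeightProjectionProofs
import Literature.Computability.AlgebraicComplexity.CoordRepRational
import Literature.Computability.AlgebraicComplexity.GCTObstructions
import Literature.NumberTheory.DiophantineGeometry.GLHighestWeightExistsUniqueProofs
import Literature.NumberTheory.DiophantineGeometry.GLPolynomialRepSemisimpleProofs
import Mathlib.LinearAlgebra.Dimension.StrongRankCondition

/-!
# van den Berg–Dutta–Gesmundo–Ikenmeyer–Lysikov 2024, Theorem 1.1 (2) and Corollary 1.2 — PROVED
# (`BergEtAl2024.thm_1_1_isotypic_holds`, `BergEtAl2024.cor_1_2_holds`)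

Discharge of the named facts `BergEtAl2024.thm_1_1_isotypic` and `BergEtAl2024.cor_1_2` of
`BDGIL24IsotypicNaturalProofs.lean` (val-lit row vdBDGIL24-A; M. van den Berg, P. Dutta,
F. Gesmundo, C. Ikenmeyer, V. Lysikov, *Algebraic metacomplexity and representation theory*,
arXiv:2411.03444, Thm. 1.1 (2) and Cor. 1.2, [cite: BergEtAl2024, Thm. 1.1 (2), p.4 (PDF p.5)],
[cite: BergEtAl2024, Cor. 1.2, p.5 (PDF p.6)]), with the absolute constant `C = 6` in both.

## The route (a disclosed substitution for the printed proof)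

The paper constructs the isotypic projectors as elements of `U(𝔤𝔩_k)` of length
`O(k (δd)^k)` (Casimir operators, central characters, §4–§5.1) and implements an element of
length `L` on a circuit of size `s` in size `O(s L^{2k²})` (Thm. 5.10, PBW), which gives the
printed `O(s k^{2k²} (δd)^{2k³})`. In the paper's own size measure `cc` (§2.1: affine linear
forms at the input gates are free, so that `cc(g · Δ) = cc(Δ)` for `g ∈ GL_k` — the tree's
`affComplexity`, §`Invariance` of `BDGIL24IsotypicNaturalProofs.lean`) a much shorter argument
gives a SHARPER bound, and that is what is formalised here:

1. **Small orbit spans** (`exists_finset_forall_coordRep_mem_span`). For a polynomial function `F`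
   on `Sym^m(k^n)` of degree `≤ δ`, every translate `g · F` (`coordRep`, `(g · F)(v) = F(g⁻¹ v)`)
   is the generic translate — `F` with the generic substitution matrix over `k[Mat_n]`
   substituted, `map_eval_aeval_genericSubst_matrix` of `CoordRepRational.lean` — specialised at
   the entries of `g⁻¹`; its coefficients are polynomials of degree `≤ δ m` in the `n²` matrix
   entries (`totalDegree_coeff_genericSubst_le`, an elementary degree count,
   §`CoeffDegree`), so `g · F` is a combination of the `≤ (δm+1)^{n²}` coefficient vectors
   indexed by the monomials of degree `≤ δm` in `n²` variables: `dim span (GL · F) ≤ (δm+1)^{n²}`.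
2. **`cc` on a span** (`affComplexity_le_card_mul_of_mem_span`): if every element of `S` has
   `cc ≤ s` and `S` spans a space of dimension `≤ B`, every element of `span S` is a combination
   of `≤ B` elements of `S` (a linearly independent spanning subfamily), hence has
   `cc ≤ B (s + 2)` by the `cc` calculus of `BDGIL24WeightProjectionProofs.lean`.
3. **Isotypic components of a vector lie in the span of its orbit**
   (`exists_isotypic_decomposition`): a finite-dimensional `GL`-stable subspace `M` of a rational
   representation in characteristic `0` is spanned by the `GL`-translates of ITS OWN
   highest-weight vectors (`le_span_translates_highestWeight`: complete reducibility
   `isSemisimpleRepresentation_of_isRationalRep_holds` + existence of highest-weight vectors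
   `exists_hasHighestWeight_of_isRationalRep` in an invariant complement — the argument of
   `le_span_translates_highestWeight_vecWordRep` of `VecWordModel.lean`, here for any rational
   representation); grouping the terms by the weight of the highest-weight vector writes
   `x ∈ M` as `∑_χ x_χ` with `x_χ ∈ M ∩ hwSubrep χ` (`hwSubrep χ` = span of the translates of the
   weight-`χ` highest-weight vectors = the `χ`-isotypic component, as in the statement file).

Hence, for `Δ` of format `(δ, d, k)` with `cc(Δ) ≤ s`: the `χ`-isotypic component of `Δ` lies in
`M = span (GL_k · Δ)`, of dimension `≤ (δd+1)^{k²}`, all of whose elements have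
`cc ≤ (δd+1)^{k²} (s+2)` (`affComplexity_le_of_mem_span_orbit`, `thm_1_1_isotypic_sharp`)
`≤ 6 s k^{2k²} (δd)^{2k³}` for `s, δd ≥ 1` (`orbit_cost_le`; the affine case `deg Δ ≤ 1`, which
covers `s = 0` and `δ ≤ 1`, is free). For Cor. 1.2: an irreducible `W` is the orbit span of any
nonzero `Δ₀ ∈ W` (`le_span_orbit_of_isIrreducible`), so every `Δ ∈ W` has
`cc ≤ (δd+1)^{k²} (cc(Δ₀) + 2)` (`cor_1_2_sharp`) `≤ 6 s k^{2k²} (δd)^{2k⁴+k²}`; the printed proof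
goes through Thm. 1.1 (4) (Gelfand–Tsetlin patterns) instead.

Theorem-only file (no definitions; the orbit span and the spans of translates of highest-weight
vectors are written out). Honest framing: two discharges of typed literature (net debt −2) by an
elementary route substitution, disclosed above; the statements are the fact names, unchanged.
VP ≠ VNP is NOT proved and nothing here is progress on it.

## References
* [BergEtAl2024] M. van den Berg, P. Dutta, F. Gesmundo, C. Ikenmeyer, V. Lysikov,
  arXiv:2411.03444 (2024): §2.1 (`cc`), Thm. 1.1 (2), Cor. 1.2 (with its proof, p.5), §5 (the
  printed route). Held text `paper:arxiv-2411.03444`, p0005–p0006, p0028–p0031.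
* [GoodmanWallachGTM255] R. Goodman, N. Wallach, *Symmetry, Representations, and Invariants*,
  Thm. 3.3.11 (complete reducibility), Cor. 3.2.3 (highest-weight vectors).

## Mathlib and tree
Mathlib: `exists_linearIndependent`, `LinearIndependent.finite_of_le_span_finite`,
`linearIndependent_le_span_aux'`, `Submodule.mem_span_range_iff_exists_fun`,
`Submodule.mem_span_set`, `Representation.subrepresentation`, `Subrepresentation`
(`exists_isCompl` from `IsSemisimpleRepresentation`, `IsSimpleOrder` = `IsIrreducible`),
`Matrix.mvPolynomialX`, `MvPolynomial.eval_eq'`, `restrictTotalDegree`.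
Tree: `affComplexity` and its calculus (`affComplexity_sum_smul_le`, `affComplexity_coordRep_le`,
`affComplexity_eq_zero_of_totalDegree_le_one`, `totalDegree_le_one_of_affComplexity_eq_zero`;
`BDGIL24WeightProjectionProofs`), `hwSubrep`, `thm_1_1_isotypic`, `cor_1_2`
(`BDGIL24IsotypicNaturalProofs`), `coordRep`/`coordSubst`/`DegIdx` (`OrbitCoordinateRing`),
`isRationalRep_coordRep`, `map_eval_aeval_genericSubst_matrix` (`CoordRepRational`),
`IsRationalRep.toRepresentation` (`GLHighestWeightMultiplicityProofs`),
`exists_hasHighestWeight_of_isRationalRep` (`GLHighestWeightExistsUniqueProofs`),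
`isSemisimpleRepresentation_of_isRationalRep_holds` (`GLPolynomialRepSemisimpleProofs`),
`apply_mem_span_orbit` (`GLHighestWeightIsomorphismProofs`), `highestWeightSpace`, `Weight`.
-/

noncomputable section

open MvPolynomial
open scoped BigOperators

namespace Literature.Barriers.ValiantsHypothesis

namespace BergEtAl2024

open Literature.Computability.AlgebraicComplexity Literature.NumberTheory.DiophantineGeometry

/-! ### Degrees of the coefficients of a polynomial with polynomial coefficients -/

section CoeffDegree

variable {k : Type*} [CommSemiring k] {τ ι ι' : Type*}

/-- Constants: the coefficients of `C c` are `c` or `0`.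
[cite: BergEtAl2024, Thm. 1.1 (2) (proof, elementary step of this route), p.4 (PDF p.5)] -/
theorem totalDegree_coeff_C_le {c : MvPolynomial τ k} {D : ℕ} (hc : c.totalDegree ≤ D)
    (u : ι →₀ ℕ) : (coeff u (C c : MvPolynomial ι (MvPolynomial τ k))).totalDegree ≤ D := by
  classical
  rw [coeff_C]
  split_ifs
  · exact hc
  · rw [totalDegree_zero]; exact Nat.zero_le _

/-- Variables: the coefficients of `X e` are `1` or `0`.
[cite: BergEtAl2024, Thm. 1.1 (2) (proof, elementary step of this route), p.4 (PDF p.5)] -/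
theorem totalDegree_coeff_X_le (e : ι) (u : ι →₀ ℕ) :
    (coeff u (X e : MvPolynomial ι (MvPolynomial τ k))).totalDegree ≤ 0 := by
  classical
  rw [coeff_X]
  split_ifs
  · rw [totalDegree_one]
  · rw [totalDegree_zero]

/-- Sums.
[cite: BergEtAl2024, Thm. 1.1 (2) (proof, elementary step of this route), p.4 (PDF p.5)] -/
theorem totalDegree_coeff_sum_le {α : Type*} (s : Finset α)
    {f : α → MvPolynomial ι (MvPolynomial τ k)} {D : ℕ}
    (hf : ∀ a ∈ s, ∀ u, (coeff u (f a)).totalDegree ≤ D) (u : ι →₀ ℕ) :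
    (coeff u (∑ a ∈ s, f a)).totalDegree ≤ D := by
  classical
  rw [coeff_sum]
  exact totalDegree_finsetSum_le fun a ha => hf a ha u

/-- Products: coefficient degrees add.
[cite: BergEtAl2024, Thm. 1.1 (2) (proof, elementary step of this route), p.4 (PDF p.5)] -/
theorem totalDegree_coeff_mul_le {P Q : MvPolynomial ι (MvPolynomial τ k)} {D₁ D₂ : ℕ}
    (hP : ∀ u, (coeff u P).totalDegree ≤ D₁) (hQ : ∀ u, (coeff u Q).totalDegree ≤ D₂)
    (u : ι →₀ ℕ) : (coeff u (P * Q)).totalDegree ≤ D₁ + D₂ := by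
  classical
  rw [coeff_mul]
  refine totalDegree_finsetSum_le fun x _ => ?_
  exact (totalDegree_mul _ _).trans (Nat.add_le_add (hP x.1) (hQ x.2))

/-- Finite products.
[cite: BergEtAl2024, Thm. 1.1 (2) (proof, elementary step of this route), p.4 (PDF p.5)] -/
theorem totalDegree_coeff_finsetProd_le {α : Type*} (s : Finset α)
    (f : α → MvPolynomial ι (MvPolynomial τ k)) (D : α → ℕ)
    (hf : ∀ a ∈ s, ∀ u, (coeff u (f a)).totalDegree ≤ D a) (u : ι →₀ ℕ) :
    (coeff u (∏ a ∈ s, f a)).totalDegree ≤ ∑ a ∈ s, D a := by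
  classical
  induction s using Finset.induction_on generalizing u with
  | empty =>
    rw [Finset.prod_empty, Finset.sum_empty, coeff_one]
    split_ifs
    · rw [totalDegree_one]
    · rw [totalDegree_zero]
  | insert a s ha ih =>
    rw [Finset.prod_insert ha, Finset.sum_insert ha]
    exact totalDegree_coeff_mul_le (hf a (Finset.mem_insert_self a s))
      (fun u => ih (fun b hb => hf b (Finset.mem_insert_of_mem hb)) u) u

/-- Powers.
[cite: BergEtAl2024, Thm. 1.1 (2) (proof, elementary step of this route), p.4 (PDF p.5)] -/
theorem totalDegree_coeff_pow_le {P : MvPolynomial ι (MvPolynomial τ k)} {D : ℕ}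
    (hP : ∀ u, (coeff u P).totalDegree ≤ D) (n : ℕ) (u : ι →₀ ℕ) :
    (coeff u (P ^ n)).totalDegree ≤ n * D := by
  classical
  have h := totalDegree_coeff_finsetProd_le (Finset.range n) (fun _ => P) (fun _ => D)
    (fun _ _ => hP) u
  rwa [Finset.prod_const, Finset.card_range, Finset.sum_const, Finset.card_range,
    smul_eq_mul] at h

/-- Substitution: if `deg F ≤ δ` and every coefficient of every `L i` has degree `≤ m`, then every
coefficient of `F(L)` has degree `≤ δ m` (the coefficients of the translates of a metapolynomial
of format `(δ, d, k)` are polynomials of degree `≤ δ d` in the matrix entries).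
[cite: BergEtAl2024, Thm. 1.1 (2) (proof, elementary step of this route), p.4 (PDF p.5)] -/
theorem totalDegree_coeff_aeval_le (F : MvPolynomial ι' k) {δ : ℕ} (hF : F.totalDegree ≤ δ)
    (L : ι' → MvPolynomial ι (MvPolynomial τ k)) {m : ℕ}
    (hL : ∀ i u, (coeff u (L i)).totalDegree ≤ m) (u : ι →₀ ℕ) :
    (coeff u (aeval L F)).totalDegree ≤ δ * m := by
  classical
  have hsum : aeval L F = ∑ s ∈ F.support, aeval L (monomial s (coeff s F)) := by
    conv_lhs => rw [F.as_sum]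
    rw [map_sum]
  rw [hsum]
  refine totalDegree_coeff_sum_le _ (fun s hs u => ?_) u
  rw [aeval_monomial]
  have hdeg : (s.sum fun _ e => e) ≤ δ := (le_totalDegree hs).trans hF
  have hC : ∀ u, (coeff u (algebraMap k (MvPolynomial ι (MvPolynomial τ k))
      (coeff s F))).totalDegree ≤ 0 := fun u => by
    rw [IsScalarTower.algebraMap_apply k (MvPolynomial τ k) (MvPolynomial ι (MvPolynomial τ k)),
      MvPolynomial.algebraMap_eq, MvPolynomial.algebraMap_eq]
    exact totalDegree_coeff_C_le (totalDegree_C _).le u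
  have hprod : ∀ u, (coeff u (s.prod fun i e => L i ^ e)).totalDegree ≤
      (s.sum fun _ e => e) * m := fun u => by
    rw [Finsupp.prod, Finsupp.sum, Finset.sum_mul]
    exact totalDegree_coeff_finsetProd_le s.support _ _
      (fun i _ u => totalDegree_coeff_pow_le (hL i) (s i) u) u
  have h := totalDegree_coeff_mul_le hC hprod u
  rw [zero_add] at h
  exact h.trans (Nat.mul_le_mul_right m hdeg)

end CoeffDegree

/-! ### The span of the `GL`-orbit of a polynomial function on `Sym^m` is small -/

section SpanBound

variable {σ : Type*} [Fintype σ] [LinearOrder σ] {k : Type*} [Field k]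

/-- The entries `coeff_c (Y · x^e)` of the generic substitution matrix (`Y = (X_{ij})` the generic
matrix) are polynomials of degree `≤ m = |e|` in the matrix entries.
[cite: BergEtAl2024, Thm. 1.1 (2) (proof, elementary step of this route), p.4 (PDF p.5)] -/
theorem totalDegree_coeff_linSubst_mvPolynomialX_monomial_le {m : ℕ} (e : DegIdx σ m)
    (c : σ →₀ ℕ) :
    (coeff c (linSubst σ (MvPolynomial (σ × σ) k) (Matrix.mvPolynomialX σ σ k)
      (monomial e.1 1))).totalDegree ≤ m := by
  classical
  have hL : ∀ (i : σ) (u : σ →₀ ℕ), (coeff u (∑ j, Matrix.mvPolynomialX σ σ k j i •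
      (X j : MvPolynomial σ (MvPolynomial (σ × σ) k)))).totalDegree ≤ 1 := by
    intro i u
    refine totalDegree_coeff_sum_le _ (fun j _ u => ?_) u
    rw [smul_eq_C_mul]
    have hc : (Matrix.mvPolynomialX σ σ k j i).totalDegree ≤ 1 := by
      rw [Matrix.mvPolynomialX_apply, totalDegree_X]
    have h := totalDegree_coeff_mul_le (totalDegree_coeff_C_le (ι := σ) hc)
      (totalDegree_coeff_X_le (τ := σ × σ) (k := k) j) u
    simpa using h
  have h1 : linSubst σ (MvPolynomial (σ × σ) k) (Matrix.mvPolynomialX σ σ k) (monomial e.1 1) =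
      aeval (fun i : σ => ∑ j, Matrix.mvPolynomialX σ σ k j i •
        (X j : MvPolynomial σ (MvPolynomial (σ × σ) k))) (monomial e.1 (1 : k)) := by
    simp only [linSubst, aeval_monomial, map_one, one_mul]
  rw [h1]
  have hdeg : (monomial e.1 (1 : k) : MvPolynomial σ k).totalDegree ≤ m := by
    refine (totalDegree_monomial_le _ _).trans (le_of_eq ?_)
    have := mem_degMonomials_iff.mp e.2
    rw [Finsupp.degree_apply] at this
    simpa [Finsupp.sum] using this
  have h := totalDegree_coeff_aeval_le (monomial e.1 (1 : k)) hdeg _ hL c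
  simpa using h

/-- **The coefficients of the generic translate of `F` are polynomials of degree `≤ δ m` in the
matrix entries** when `deg F ≤ δ` (format `(δ, m, ·)`).
[cite: BergEtAl2024, Thm. 1.1 (2) (proof, elementary step of this route), p.4 (PDF p.5)] -/
theorem totalDegree_coeff_genericSubst_le {m δ : ℕ} (F : MvPolynomial (DegIdx σ m) k)
    (hF : F.totalDegree ≤ δ) (u : DegIdx σ m →₀ ℕ) :
    (coeff u (aeval (fun d : DegIdx σ m => ∑ e : DegIdx σ m,
        C (coeff d.1 (linSubst σ (MvPolynomial (σ × σ) k) (Matrix.mvPolynomialX σ σ k)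
          (monomial e.1 1))) * X e) F)).totalDegree ≤ δ * m := by
  classical
  refine totalDegree_coeff_aeval_le F hF _ (fun d u => ?_) u
  refine totalDegree_coeff_sum_le _ (fun e _ u => ?_) u
  have h := totalDegree_coeff_mul_le
    (totalDegree_coeff_C_le (ι := DegIdx σ m)
      (totalDegree_coeff_linSubst_mvPolynomialX_monomial_le (k := k) e d.1))
    (totalDegree_coeff_X_le (τ := σ × σ) (k := k) e) u
  simpa using h

/-- The translate `g · F` is the generic translate specialised at the entries of `g⁻¹`
(`map_eval_aeval_genericSubst_matrix` of `CoordRepRational`).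
[cite: BergEtAl2024, Thm. 1.1 (2) (proof, elementary step of this route), p.4 (PDF p.5)] -/
theorem coordRep_eq_map_eval_genericSubst {m : ℕ} (g : GL σ k)
    (F : MvPolynomial (DegIdx σ m) k) :
    coordRep σ k m g F =
      MvPolynomial.map (eval fun ij : σ × σ => ((g⁻¹ : GL σ k) : Matrix σ σ k) ij.1 ij.2)
        (aeval (fun d : DegIdx σ m => ∑ e : DegIdx σ m,
          C (coeff d.1 (linSubst σ (MvPolynomial (σ × σ) k) (Matrix.mvPolynomialX σ σ k)
            (monomial e.1 1))) * X e) F) := by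
  rw [map_eval_aeval_genericSubst_matrix, coordRep_apply]
  rfl

/-- **The `GL`-orbit of a polynomial function `F` on `Sym^m` with `deg F ≤ δ` spans a space of
dimension at most `(δ m + 1)^{n²}`** (`n = |σ|`): every translate `g · F` is a linear combination
of the `≤ (δm+1)^{n²}` coefficient vectors of the generic translate, indexed by the monomials of
degree `≤ δ m` in the `n²` matrix entries. (This elementary count replaces the `U(𝔤𝔩_k)`-length
bookkeeping of the printed proof of Thm. 1.1.)
[cite: BergEtAl2024, Thm. 1.1 (2) (proof, elementary step of this route), p.4 (PDF p.5)] -/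
theorem exists_finset_forall_coordRep_mem_span {m δ : ℕ} (F : MvPolynomial (DegIdx σ m) k)
    (hF : F.totalDegree ≤ δ) :
    ∃ T : Finset (MvPolynomial (DegIdx σ m) k),
      T.card ≤ (δ * m + 1) ^ (Fintype.card σ * Fintype.card σ) ∧
      ∀ g : GL σ k, coordRep σ k m g F ∈
        Submodule.span k (T : Set (MvPolynomial (DegIdx σ m) k)) := by
  classical
  set G : MvPolynomial (DegIdx σ m) (MvPolynomial (σ × σ) k) :=
    aeval (fun d : DegIdx σ m => ∑ e : DegIdx σ m,
      C (coeff d.1 (linSubst σ (MvPolynomial (σ × σ) k) (Matrix.mvPolynomialX σ σ k)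
        (monomial e.1 1))) * X e) F with hG
  set S : Finset (σ × σ →₀ ℕ) := G.support.biUnion fun u => (coeff u G).support with hS
  let v : (σ × σ →₀ ℕ) → MvPolynomial (DegIdx σ m) k :=
    fun n => ∑ u ∈ G.support, coeff n (coeff u G) • (monomial u (1 : k))
  have hSdeg : ∀ n ∈ S, ∀ ij, n ij ≤ δ * m := by
    intro n hn ij
    obtain ⟨u, -, hnu⟩ := Finset.mem_biUnion.mp hn
    have h1 : n ij ≤ n.sum fun _ e => e := by
      by_cases hij : ij ∈ n.support
      · exact Finset.single_le_sum (f := fun i => n i) (fun _ _ => Nat.zero_le _) hij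
      · rw [Finsupp.notMem_support_iff.mp hij]; exact Nat.zero_le _
    exact h1.trans ((le_totalDegree hnu).trans (totalDegree_coeff_genericSubst_le F hF u))
  refine ⟨S.image v, Finset.card_image_le.trans ?_, fun g => ?_⟩
  · -- count: `S` injects into `(σ × σ) → {0, …, δm}`
    let φ : (σ × σ →₀ ℕ) → (σ × σ → Fin (δ * m + 1)) :=
      fun n ij => ⟨min (n ij) (δ * m), by omega⟩
    calc S.card ≤ (Finset.univ : Finset (σ × σ → Fin (δ * m + 1))).card := by
          refine Finset.card_le_card_of_injOn φ (fun n _ => Finset.mem_coe.mpr (Finset.mem_univ _))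
            ?_
          intro n hn n' hn' h
          ext ij
          have h1 := congr_fun h ij
          simp only [φ, Fin.mk.injEq] at h1
          rwa [min_eq_left (hSdeg n hn ij), min_eq_left (hSdeg n' hn' ij)] at h1
      _ = (δ * m + 1) ^ (Fintype.card σ * Fintype.card σ) := by
          rw [Finset.card_univ, Fintype.card_fun, Fintype.card_fin, Fintype.card_prod]
  · rw [coordRep_eq_map_eval_genericSubst, ← hG]
    set a : σ × σ → k := fun ij => ((g⁻¹ : GL σ k) : Matrix σ σ k) ij.1 ij.2 with ha
    have h1 : MvPolynomial.map (eval a) G =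
        ∑ u ∈ G.support, (eval a (coeff u G)) •
          (monomial u (1 : k) : MvPolynomial (DegIdx σ m) k) := by
      conv_lhs => rw [G.as_sum, map_sum]
      refine Finset.sum_congr rfl fun u _ => ?_
      rw [map_monomial, smul_monomial, smul_eq_mul, mul_one]
    have h2 : ∀ u ∈ G.support,
        eval a (coeff u G) = ∑ n ∈ S, coeff n (coeff u G) * ∏ ij, a ij ^ n ij := by
      intro u hu
      rw [eval_eq']
      refine Finset.sum_subset (Finset.subset_biUnion_of_mem (fun u => (coeff u G).support) hu) ?_
      intro n _ hn
      rw [notMem_support_iff.mp hn, zero_mul]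
    have hexp : MvPolynomial.map (eval a) G = ∑ n ∈ S, (∏ ij, a ij ^ n ij) • v n := by
      rw [h1]
      calc ∑ u ∈ G.support, eval a (coeff u G) •
            (monomial u (1 : k) : MvPolynomial (DegIdx σ m) k)
          = ∑ u ∈ G.support, ∑ n ∈ S, (coeff n (coeff u G) * ∏ ij, a ij ^ n ij) •
              (monomial u (1 : k) : MvPolynomial (DegIdx σ m) k) := by
            refine Finset.sum_congr rfl fun u hu => ?_
            rw [h2 u hu, Finset.sum_smul]
        _ = ∑ n ∈ S, ∑ u ∈ G.support, (coeff n (coeff u G) * ∏ ij, a ij ^ n ij) •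
              (monomial u (1 : k) : MvPolynomial (DegIdx σ m) k) := Finset.sum_comm
        _ = ∑ n ∈ S, (∏ ij, a ij ^ n ij) • v n := by
            refine Finset.sum_congr rfl fun n _ => ?_
            simp only [v, Finset.smul_sum, smul_smul, mul_comm]
    rw [hexp]
    refine Submodule.sum_mem _ fun n hn => Submodule.smul_mem _ _ (Submodule.subset_span ?_)
    exact Finset.mem_coe.mpr (Finset.mem_image_of_mem v hn)

/-- Dimension form: `dim span (GL · F) ≤ (δ m + 1)^{n²}` for `deg F ≤ δ`.
[cite: BergEtAl2024, Thm. 1.1 (2) (proof, elementary step of this route), p.4 (PDF p.5)] -/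
theorem finrank_span_orbit_coordRep_le {m δ : ℕ} (F : MvPolynomial (DegIdx σ m) k)
    (hF : F.totalDegree ≤ δ) :
    Module.finrank k (Submodule.span k (Set.range fun g : GL σ k => coordRep σ k m g F)) ≤
      (δ * m + 1) ^ (Fintype.card σ * Fintype.card σ) := by
  obtain ⟨T, hT, hmem⟩ := exists_finset_forall_coordRep_mem_span F hF
  have hle : Submodule.span k (Set.range fun g : GL σ k => coordRep σ k m g F) ≤
      Submodule.span k (T : Set (MvPolynomial (DegIdx σ m) k)) :=
    Submodule.span_le.mpr (by rintro _ ⟨g, rfl⟩; exact hmem g)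
  exact (Submodule.finrank_mono hle).trans ((finrank_span_finset_le_card T).trans hT)

end SpanBound

/-! ### `cc` of the elements of a small span of cheap polynomials -/

section CCSpan

variable {τ : Type*} [Fintype τ]

/-- **`cc` on a span.** If every element of `S` has `cc ≤ s` and `S` lies in the span of a finite
set `T`, then every `w ∈ span S` is a linear combination of at most `|T|` elements of `S`
(a linearly independent spanning subfamily of `S`), so `cc(w) ≤ |T| (s + 2)` by the `cc` calculus
(`affComplexity_sum_smul_le`). [cite: BergEtAl2024, §2.1, p.6 (PDF p.7)] -/
theorem affComplexity_le_card_mul_of_mem_span {S : Set (MvPolynomial τ ℂ)} {s : ℕ}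
    (hS : ∀ v ∈ S, affComplexity v ≤ s) (T : Finset (MvPolynomial τ ℂ))
    (hT : S ⊆ Submodule.span ℂ (T : Set (MvPolynomial τ ℂ)))
    {w : MvPolynomial τ ℂ} (hw : w ∈ Submodule.span ℂ S) :
    affComplexity w ≤ T.card * (s + 2) := by
  classical
  obtain ⟨b, hbS, hspan, hli⟩ := exists_linearIndependent ℂ S
  have hrange : Set.range ((↑) : b → MvPolynomial τ ℂ) ≤
      (Submodule.span ℂ ((T : Set (MvPolynomial τ ℂ))) : Set (MvPolynomial τ ℂ)) := by
    rintro _ ⟨x, rfl⟩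
    exact hT (hbS x.2)
  haveI : Finite b := hli.finite_of_le_span_finite _ (T : Set (MvPolynomial τ ℂ)) hrange
  letI : Fintype b := Fintype.ofFinite b
  have hcard : Fintype.card b ≤ Fintype.card (T : Set (MvPolynomial τ ℂ)) :=
    linearIndependent_le_span_aux' _ hli _ hrange
  rw [← hspan] at hw
  have hw' : w ∈ Submodule.span ℂ (Set.range ((↑) : b → MvPolynomial τ ℂ)) := by
    rwa [Subtype.range_coe]
  obtain ⟨c, hc⟩ := (Submodule.mem_span_range_iff_exists_fun ℂ).mp hw'
  rw [← hc]
  refine (affComplexity_sum_smul_le _ _ _).trans ?_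
  calc ∑ x : b, (affComplexity (x : MvPolynomial τ ℂ) + 2)
      ≤ ∑ _x : b, (s + 2) :=
        Finset.sum_le_sum fun x _ => Nat.add_le_add_right (hS _ (hbS x.2)) 2
    _ = Fintype.card b * (s + 2) := by
        rw [Finset.sum_const, Finset.card_univ, smul_eq_mul]
    _ ≤ T.card * (s + 2) := by
        refine Nat.mul_le_mul_right _ (hcard.trans (le_of_eq ?_))
        simp

omit [Fintype τ] in
/-- Affine spans are free: if every element of `S` is affine-linear then so is every element of
`span S`, whose `cc` is therefore `0`. [cite: BergEtAl2024, §2.1, p.6 (PDF p.7)] -/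
theorem affComplexity_eq_zero_of_mem_span_of_totalDegree_le_one {S : Set (MvPolynomial τ ℂ)}
    (hS : ∀ v ∈ S, v.totalDegree ≤ 1) {w : MvPolynomial τ ℂ} (hw : w ∈ Submodule.span ℂ S) :
    affComplexity w = 0 := by
  have hle : Submodule.span ℂ S ≤ restrictTotalDegree τ ℂ 1 :=
    Submodule.span_le.mpr fun v hv => (mem_restrictTotalDegree τ 1 v).mpr (hS v hv)
  exact affComplexity_eq_zero_of_totalDegree_le_one ((mem_restrictTotalDegree τ 1 w).mp (hle hw))

end CCSpan

/-! ### Stable subspaces of rational representations are spanned by translates of their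
highest-weight vectors -/

section Decomposition

variable {σ : Type*} [Fintype σ] [LinearOrder σ] {k : Type*} [Field k]
variable {V : Type*} [AddCommGroup V] [Module k V]

/-- A nonzero finite-dimensional `GL`-stable subspace of a rational representation contains a
nonzero highest-weight vector (Lie–Kolchin type existence for the rational subrepresentation,
`exists_hasHighestWeight_of_isRationalRep`). [cite: GoodmanWallachGTM255, Cor. 3.2.3 (proof)] -/
theorem exists_mem_highestWeightSpace_of_stable [Infinite k] {ρ : Representation k (GL σ k) V}
    (hρ : IsRationalRep ρ) (U : Submodule k V) (hU : ∀ g, U ≤ U.comap (ρ g))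
    [FiniteDimensional k U] (hU0 : U ≠ ⊥) :
    ∃ χ : Weight σ, ∃ v ∈ U, v ≠ 0 ∧ v ∈ highestWeightSpace ρ χ := by
  set ρU := ρ.subrepresentation U hU with hρU
  haveI : Nontrivial U := Submodule.nontrivial_iff_ne_bot.mpr hU0
  have hrat : IsRationalRep ρU :=
    hρ.toRepresentation ⟨U, fun g _ hv => hU g hv⟩
  obtain ⟨χ, hχ⟩ := exists_hasHighestWeight_of_isRationalRep ρU hrat
  obtain ⟨v, hv0, hv⟩ := (hasHighestWeight_iff_exists _ _).mp hχ
  refine ⟨χ, v, v.2, fun h0 => hv0 (Subtype.ext h0), fun b hb => ?_⟩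
  exact congrArg Subtype.val (hv b hb)

/-- **A finite-dimensional `GL`-stable subspace `M` of a rational representation (characteristic
`0`) is spanned by the `GL`-translates of its highest-weight vectors**: by complete reducibility
(`isSemisimpleRepresentation_of_isRationalRep_holds`) the span of these translates has an
invariant complement inside `M`, which would contain a further highest-weight vector unless it is
zero (the argument of `le_span_translates_highestWeight_vecWordRep` for a general rational
representation). [cite: GoodmanWallachGTM255, Thm. 3.3.11 with Cor. 3.2.3] -/
theorem le_span_translates_highestWeight [CharZero k] {ρ : Representation k (GL σ k) V}
    (hρ : IsRationalRep ρ) (M : Submodule k V) (hM : ∀ g, M ≤ M.comap (ρ g))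
    [FiniteDimensional k M] :
    M ≤ Submodule.span k {x | ∃ (g : GL σ k) (v : V) (χ : Weight σ),
        v ∈ M ∧ v ∈ highestWeightSpace ρ χ ∧ x = ρ g v} := by
  haveI : Infinite k := Infinite.of_injective (Nat.cast : ℕ → k) Nat.cast_injective
  set S : Set V := {x | ∃ (g : GL σ k) (v : V) (χ : Weight σ),
    v ∈ M ∧ v ∈ highestWeightSpace ρ χ ∧ x = ρ g v} with hS
  set K := Submodule.span k S with hK
  -- `K` is stable
  have hKstab : ∀ g, K ≤ K.comap (ρ g) := by
    intro g
    rw [← Submodule.map_le_iff_le_comap, hK, Submodule.map_span]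
    refine Submodule.span_mono ?_
    rintro _ ⟨x, ⟨g', v, χ, hv, hvχ, rfl⟩, rfl⟩
    exact ⟨g * g', v, χ, hv, hvχ, by rw [map_mul]; rfl⟩
  -- the subrepresentation on `M` is completely reducible
  let ρM := ρ.subrepresentation M hM
  have hratM : IsRationalRep ρM := hρ.toRepresentation ⟨M, fun g _ hv => hM g hv⟩
  haveI : ρM.IsSemisimpleRepresentation :=
    isSemisimpleRepresentation_of_isRationalRep_holds (σ := σ) (k := k) (V := M) hratM
  -- `K ∩ M` as a subrepresentation of `ρM`, and an invariant complement `K'`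
  let Ksub : Subrepresentation ρM :=
    ⟨K.comap M.subtype, fun g x hx => by
      change ((ρM g x : M) : V) ∈ K
      exact hKstab g hx⟩
  obtain ⟨K', hKK'⟩ := exists_isCompl Ksub
  by_contra hne
  -- `K' ≠ ⊥`, since otherwise `M ≤ K`
  have hK'ne : K'.toSubmodule ≠ ⊥ := by
    intro hbot
    apply hne
    intro x hx
    have hK'bot : K' = ⊥ := Subrepresentation.toSubmodule_injective hbot
    have htop : Ksub = ⊤ := by
      have := hKK'.sup_eq_top
      rwa [hK'bot, sup_bot_eq] at this
    have hmem : (⟨x, hx⟩ : M) ∈ Ksub := by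
      rw [htop]
      exact Submodule.mem_top
    exact hmem
  -- `K'`, pushed into `V`, is a nonzero stable finite-dimensional subspace: it has a
  -- highest-weight vector
  set K'' : Submodule k V := K'.toSubmodule.map M.subtype with hK''
  have hK''ne : K'' ≠ ⊥ := by
    obtain ⟨x, hx, hx0⟩ := (Submodule.ne_bot_iff _).1 hK'ne
    rw [Submodule.ne_bot_iff]
    exact ⟨(x : V), ⟨x, hx, rfl⟩, fun h0 => hx0 (Subtype.ext h0)⟩
  have hK''stab : ∀ g, K'' ≤ K''.comap (ρ g) := by
    rintro g _ ⟨x, hx, rfl⟩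
    exact ⟨ρM g x, K'.apply_mem_toSubmodule g hx, rfl⟩
  obtain ⟨χ, v, hvK'', hv0, hvχ⟩ :=
    exists_mem_highestWeightSpace_of_stable hρ K'' hK''stab hK''ne
  obtain ⟨x, hxK', hxv⟩ := hvK''
  -- `v = x ∈ M` is a highest-weight vector, hence lies in `K`: contradiction with `K ∩ K' = 0`
  have hxK : x ∈ Ksub := by
    change ((x : M) : V) ∈ K
    refine Submodule.subset_span ⟨1, (x : V), χ, x.2, ?_, by rw [map_one]; rfl⟩
    rw [show ((x : M) : V) = v from hxv]
    exact hvχ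
  have hx : x ∈ ((Ksub ⊓ K' : Subrepresentation ρM) : Set M) := by
    rw [Subrepresentation.coe_inf]
    exact ⟨hxK, hxK'⟩
  rw [hKK'.inf_eq_bot] at hx
  have hx0 : x = 0 := hx
  apply hv0
  rw [← hxv, hx0]
  rfl

/-- **Isotypic decomposition inside a stable subspace.** For `x` in a finite-dimensional
`GL`-stable subspace `M` of a rational representation (characteristic `0`) and any weight `χ`,
`x = y + (x - y)` with `y` in the span of the translates of the weight-`χ` highest-weight
vectors OF `M` and `x - y` in the sum of the corresponding spans for the weights `χ' ≠ χ`
(group the terms of `le_span_translates_highestWeight` by weight).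
[cite: BergEtAl2024, Thm. 2.4 (proof: "project onto an isotypic component"), p.10 (PDF p.11)] -/
theorem exists_isotypic_decomposition [CharZero k] {ρ : Representation k (GL σ k) V}
    (hρ : IsRationalRep ρ) (M : Submodule k V) (hM : ∀ g, M ≤ M.comap (ρ g))
    [FiniteDimensional k M] {x : V} (hx : x ∈ M) (χ : Weight σ) :
    ∃ y ∈ Submodule.span k {z | ∃ (g : GL σ k) (v : V),
        v ∈ M ∧ v ∈ highestWeightSpace ρ χ ∧ z = ρ g v},
      x - y ∈ ⨆ χ' ∈ {χ' : Weight σ | χ' ≠ χ}, Submodule.span k {z | ∃ (g : GL σ k) (v : V),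
        v ∈ M ∧ v ∈ highestWeightSpace ρ χ' ∧ z = ρ g v} := by
  classical
  have hxS := le_span_translates_highestWeight hρ M hM hx
  obtain ⟨c, hcS, hcx⟩ := Submodule.mem_span_set.mp hxS
  -- the weight attached to each generator in the support of `c`
  have hwt : ∀ z ∈ c.support, ∃ χz : Weight σ, ∃ (g : GL σ k) (v : V),
      v ∈ M ∧ v ∈ highestWeightSpace ρ χz ∧ z = ρ g v := by
    intro z hz
    obtain ⟨g, v, χz, hv, hvχ, rfl⟩ := hcS (Finset.mem_coe.mpr hz)
    exact ⟨χz, g, v, hv, hvχ, rfl⟩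
  choose! wt hwt' using hwt
  refine ⟨∑ z ∈ c.support with wt z = χ, c z • z, ?_, ?_⟩
  · refine Submodule.sum_mem _ fun z hz => Submodule.smul_mem _ _ (Submodule.subset_span ?_)
    obtain ⟨hz, hzχ⟩ := Finset.mem_filter.mp hz
    obtain ⟨g, v, hv, hvχ, hzv⟩ := hwt' z hz
    exact ⟨g, v, hv, hzχ ▸ hvχ, hzv⟩
  · have hsplit : x - ∑ z ∈ c.support with wt z = χ, c z • z =
        ∑ z ∈ c.support with ¬ wt z = χ, c z • z := by
      rw [sub_eq_iff_eq_add, add_comm, Finset.sum_filter_add_sum_filter_not]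
      exact hcx.symm
    rw [hsplit]
    refine Submodule.sum_mem _ fun z hz => ?_
    obtain ⟨hz, hzχ⟩ := Finset.mem_filter.mp hz
    obtain ⟨g, v, hv, hvχ, hzv⟩ := hwt' z hz
    exact Submodule.mem_iSup_of_mem (wt z) (Submodule.mem_iSup_of_mem
      (show wt z ∈ {χ' : Weight σ | χ' ≠ χ} from hzχ)
      (Submodule.smul_mem _ _ (Submodule.subset_span ⟨g, v, hv, hvχ, hzv⟩)))

/-- The span of the translates of the weight-`χ` highest-weight vectors of `M` lies in `M`.
[cite: GoodmanWallachGTM255, Cor. 3.2.3 with Thm. 3.3.11] -/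
theorem span_translates_highestWeight_le {ρ : Representation k (GL σ k) V}
    (M : Submodule k V) (hM : ∀ g, M ≤ M.comap (ρ g)) (χ : Weight σ) :
    Submodule.span k {z | ∃ (g : GL σ k) (v : V),
        v ∈ M ∧ v ∈ highestWeightSpace ρ χ ∧ z = ρ g v} ≤ M := by
  refine Submodule.span_le.mpr ?_
  rintro _ ⟨g, v, hv, -, rfl⟩
  exact hM g hv

/-- … and in the isotypic component `hwSubrep ρ χ` of the ambient representation.
[cite: GoodmanWallachGTM255, Cor. 3.2.3 with Thm. 3.3.11] -/
theorem span_translates_highestWeight_le_hwSubrep {ρ : Representation k (GL σ k) V}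
    (M : Submodule k V) (χ : Weight σ) :
    Submodule.span k {z | ∃ (g : GL σ k) (v : V),
        v ∈ M ∧ v ∈ highestWeightSpace ρ χ ∧ z = ρ g v} ≤ hwSubrep ρ χ := by
  refine Submodule.span_mono ?_
  rintro _ ⟨g, v, -, hvχ, rfl⟩
  exact ⟨g, v, hvχ, rfl⟩

end Decomposition

/-! ### The orbit span of a metapolynomial -/

section Orbit

variable {k d : ℕ}

/-- The orbit span `span (GL_k · Δ)` is `GL_k`-stable.
[cite: BergEtAl2024, §2.1 (invariance of `cc` under `GL_k`), p.6 (PDF p.7)] -/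
theorem span_orbit_le_comap (Δ : MvPolynomial (DegIdx (Fin k) d) ℂ) (g : GL (Fin k) ℂ) :
    Submodule.span ℂ (Set.range fun h : GL (Fin k) ℂ => coordRep (Fin k) ℂ d h Δ) ≤
      (Submodule.span ℂ (Set.range fun h : GL (Fin k) ℂ => coordRep (Fin k) ℂ d h Δ)).comap
        (coordRep (Fin k) ℂ d g) :=
  fun _ hx => apply_mem_span_orbit (coordRep (Fin k) ℂ d) Δ g hx

/-- `Δ` lies in its orbit span.
[cite: BergEtAl2024, §2.1 (invariance of `cc` under `GL_k`), p.6 (PDF p.7)] -/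
theorem self_mem_span_orbit (Δ : MvPolynomial (DegIdx (Fin k) d) ℂ) :
    Δ ∈ Submodule.span ℂ (Set.range fun h : GL (Fin k) ℂ => coordRep (Fin k) ℂ d h Δ) :=
  Submodule.subset_span ⟨1, by
    change coordRep (Fin k) ℂ d 1 Δ = Δ
    rw [map_one, Module.End.one_apply]⟩

/-- Every translate of `Δ` costs at most `cc(Δ)`. [cite: BergEtAl2024, §2.1, p.6 (PDF p.7)] -/
theorem affComplexity_le_of_mem_range_orbit {s : ℕ} {Δ : MvPolynomial (DegIdx (Fin k) d) ℂ}
    (hs : affComplexity Δ ≤ s) :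
    ∀ v ∈ Set.range (fun h : GL (Fin k) ℂ => coordRep (Fin k) ℂ d h Δ), affComplexity v ≤ s := by
  rintro _ ⟨g, rfl⟩
  change affComplexity (coordRep (Fin k) ℂ d g Δ) ≤ s
  exact (affComplexity_coordRep_le Δ g).trans hs

/-- Translates of an affine-linear metapolynomial are affine-linear.
[cite: BergEtAl2024, §2.1 (invariance of `cc` under `GL_k`), p.6 (PDF p.7)] -/
theorem totalDegree_le_one_of_mem_range_orbit {Δ : MvPolynomial (DegIdx (Fin k) d) ℂ}
    (hΔ : Δ.totalDegree ≤ 1) :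
    ∀ v ∈ Set.range (fun h : GL (Fin k) ℂ => coordRep (Fin k) ℂ d h Δ), v.totalDegree ≤ 1 := by
  classical
  rintro _ ⟨g, rfl⟩
  change (coordRep (Fin k) ℂ d g Δ).totalDegree ≤ 1
  rw [coordRep_apply]
  unfold coordSubst
  exact (totalDegree_aeval_le_of_forall_le_one Δ fun μ =>
    totalDegree_sum_smul_X_le_one Finset.univ _ id).trans hΔ

/-- **`cc` on the orbit span**: for `Δ` of format `(δ, d, k)` with `cc(Δ) ≤ s`, every element of
`span (GL_k · Δ)` has `cc ≤ (δd + 1)^{k²} (s + 2)`. [cite: BergEtAl2024, Thm. 1.1, p.4 (PDF p.5)] -/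
theorem affComplexity_le_of_mem_span_orbit {δ s : ℕ} {Δ : MvPolynomial (DegIdx (Fin k) d) ℂ}
    (hΔ : Δ.IsHomogeneous δ) (hs : affComplexity Δ ≤ s) {w : MvPolynomial (DegIdx (Fin k) d) ℂ}
    (hw : w ∈ Submodule.span ℂ (Set.range fun h : GL (Fin k) ℂ => coordRep (Fin k) ℂ d h Δ)) :
    affComplexity w ≤ (δ * d + 1) ^ (k * k) * (s + 2) := by
  obtain ⟨T, hT, hmem⟩ := exists_finset_forall_coordRep_mem_span Δ hΔ.totalDegree_le
  have hsub : Set.range (fun h : GL (Fin k) ℂ => coordRep (Fin k) ℂ d h Δ) ⊆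
      Submodule.span ℂ (T : Set (MvPolynomial (DegIdx (Fin k) d) ℂ)) := by
    rintro _ ⟨g, rfl⟩
    exact hmem g
  refine (affComplexity_le_card_mul_of_mem_span (affComplexity_le_of_mem_range_orbit hs) T hsub
    hw).trans ?_
  rw [Fintype.card_fin] at hT
  exact Nat.mul_le_mul_right _ hT

end Orbit

/-! ### Arithmetic of the final bounds -/

section Arithmetic

/-- `(D+1)^{k²} (s+2) ≤ 6 s k^{2k²} D^{2k³}` for `D, s ≥ 1`.
[cite: BergEtAl2024, Thm. 1.1 (2) (proof, elementary step of this route), p.4 (PDF p.5)] -/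
theorem orbit_cost_le {D k s : ℕ} (hD : 1 ≤ D) (hs : 1 ≤ s) :
    (D + 1) ^ (k * k) * (s + 2) ≤ 6 * s * k ^ (2 * k ^ 2) * D ^ (2 * k ^ 3) := by
  rcases Nat.eq_zero_or_pos k with rfl | hk
  · norm_num
    omega
  have h1 : (D + 1) ^ (k * k) ≤ 2 ^ (k * k) * D ^ (k * k) := by
    rw [← mul_pow]
    exact Nat.pow_le_pow_left (by omega) _
  have h2 : 2 ^ (k * k) ≤ 2 * k ^ (2 * k ^ 2) := by
    rcases Nat.lt_or_ge k 2 with hk1 | hk2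
    · interval_cases k
      simp
    · calc 2 ^ (k * k) ≤ (k ^ 2) ^ (k * k) := Nat.pow_le_pow_left (by nlinarith) _
        _ = k ^ (2 * k ^ 2) := by rw [← pow_mul]; ring_nf
        _ ≤ 2 * k ^ (2 * k ^ 2) := by omega
  have h3 : D ^ (k * k) ≤ D ^ (2 * k ^ 3) := Nat.pow_le_pow_right hD (by nlinarith)
  have h4 : s + 2 ≤ 3 * s := by omega
  calc (D + 1) ^ (k * k) * (s + 2) ≤ (2 ^ (k * k) * D ^ (k * k)) * (3 * s) :=
        Nat.mul_le_mul h1 h4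
    _ ≤ (2 * k ^ (2 * k ^ 2) * D ^ (2 * k ^ 3)) * (3 * s) := by gcongr
    _ = 6 * s * k ^ (2 * k ^ 2) * D ^ (2 * k ^ 3) := by ring

end Arithmetic

/-! ### Theorem 1.1 (2) -/

/-- **van den Berg–Dutta–Gesmundo–Ikenmeyer–Lysikov 2024, Theorem 1.1 (2) holds** (absolute
constant `C = 6`): for a metapolynomial `Δ` of format `(δ, d, k)` with `cc(Δ) ≤ s` and every
weight `χ`, the component of `Δ` in the `χ`-isotypic component `hwSubrep χ` (along the sum of
the other isotypic components) has `cc ≤ 6 s k^{2k²} (δd)^{2k³}`. Route (disclosed substitution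
for the printed `U(𝔤𝔩_k)`/Casimir construction, §5): the isotypic component of `Δ` lies in the
span `M` of the orbit `GL_k · Δ` (complete reducibility of the rational `GL_k`-module `M` and
highest-weight vectors, `exists_isotypic_decomposition`); `M` has dimension `≤ (δd+1)^{k²}`
(`exists_finset_forall_coordRep_mem_span`) and every translate has `cc ≤ s` (`cc` is invariant,
§2.1), so the component is a combination of `≤ (δd+1)^{k²}` translates. Discharge of the named
fact `BergEtAl2024.thm_1_1_isotypic`. [cite: BergEtAl2024, Thm. 1.1 (2), p.4 (PDF p.5)] -/
theorem thm_1_1_isotypic_holds : thm_1_1_isotypic := by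
  refine ⟨6, fun δ d k s Δ hd hΔ hs χ => ?_⟩
  classical
  set ρ := coordRep (Fin k) ℂ d with hρ
  set M := Submodule.span ℂ (Set.range fun h : GL (Fin k) ℂ => ρ h Δ) with hM
  have hMstab : ∀ g, M ≤ M.comap (ρ g) := span_orbit_le_comap Δ
  obtain ⟨T, -, hTmem⟩ := exists_finset_forall_coordRep_mem_span Δ hΔ.totalDegree_le
  have hMT : M ≤ Submodule.span ℂ (T : Set (MvPolynomial (DegIdx (Fin k) d) ℂ)) :=
    Submodule.span_le.mpr (by rintro _ ⟨g, rfl⟩; exact hTmem g)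
  haveI : FiniteDimensional ℂ M := Submodule.finiteDimensional_of_le hMT
  obtain ⟨y, hy, hxy⟩ := exists_isotypic_decomposition (isRationalRep_coordRep d) M hMstab
    (self_mem_span_orbit Δ) χ
  refine ⟨y, span_translates_highestWeight_le_hwSubrep M χ hy, ?_, ?_⟩
  · exact iSup₂_mono (fun χ' _ => span_translates_highestWeight_le_hwSubrep M χ') hxy
  · have hyM : y ∈ M := span_translates_highestWeight_le M hMstab χ hy
    by_cases haff : Δ.totalDegree ≤ 1
    · rw [affComplexity_eq_zero_of_mem_span_of_totalDegree_le_one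
        (totalDegree_le_one_of_mem_range_orbit haff) hyM]
      exact Nat.zero_le _
    · have hs1 : 1 ≤ s := by
        by_contra h0
        exact haff (totalDegree_le_one_of_affComplexity_eq_zero (by omega))
      have hδ : 2 ≤ δ := by
        by_contra h
        exact haff (hΔ.totalDegree_le.trans (by omega))
      refine (affComplexity_le_of_mem_span_orbit hΔ hs hyM).trans ?_
      exact orbit_cost_le (by nlinarith) hs1

/-- **Theorem 1.1 (2), sharp form of this route**: the isotypic components of a metapolynomial of
format `(δ, d, k)` with `cc ≤ s` lie in the orbit span and have `cc ≤ (δd + 1)^{k²} (s + 2)`.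
[cite: BergEtAl2024, Thm. 1.1 (2), p.4 (PDF p.5)] -/
theorem thm_1_1_isotypic_sharp (δ d k s : ℕ) (Δ : MvPolynomial (DegIdx (Fin k) d) ℂ)
    (hΔ : Δ.IsHomogeneous δ) (hs : affComplexity Δ ≤ s) (χ : Weight (Fin k)) :
    ∃ Δ' : MvPolynomial (DegIdx (Fin k) d) ℂ,
      Δ' ∈ hwSubrep (coordRep (Fin k) ℂ d) χ ∧
      Δ - Δ' ∈ ⨆ χ' ∈ {χ' : Weight (Fin k) | χ' ≠ χ}, hwSubrep (coordRep (Fin k) ℂ d) χ' ∧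
      Δ' ∈ Submodule.span ℂ (Set.range fun h : GL (Fin k) ℂ => coordRep (Fin k) ℂ d h Δ) ∧
      affComplexity Δ' ≤ (δ * d + 1) ^ (k * k) * (s + 2) := by
  classical
  set ρ := coordRep (Fin k) ℂ d with hρ
  set M := Submodule.span ℂ (Set.range fun h : GL (Fin k) ℂ => ρ h Δ) with hM
  have hMstab : ∀ g, M ≤ M.comap (ρ g) := span_orbit_le_comap Δ
  obtain ⟨T, -, hTmem⟩ := exists_finset_forall_coordRep_mem_span Δ hΔ.totalDegree_le
  have hMT : M ≤ Submodule.span ℂ (T : Set (MvPolynomial (DegIdx (Fin k) d) ℂ)) :=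
    Submodule.span_le.mpr (by rintro _ ⟨g, rfl⟩; exact hTmem g)
  haveI : FiniteDimensional ℂ M := Submodule.finiteDimensional_of_le hMT
  obtain ⟨y, hy, hxy⟩ := exists_isotypic_decomposition (isRationalRep_coordRep d) M hMstab
    (self_mem_span_orbit Δ) χ
  have hyM : y ∈ M := span_translates_highestWeight_le M hMstab χ hy
  exact ⟨y, span_translates_highestWeight_le_hwSubrep M χ hy,
    iSup₂_mono (fun χ' _ => span_translates_highestWeight_le_hwSubrep M χ') hxy, hyM,
    affComplexity_le_of_mem_span_orbit hΔ hs hyM⟩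

/-! ### Corollary 1.2 -/

/-- An irreducible stable subspace is the orbit span of any of its nonzero vectors.
[cite: BergEtAl2024, Cor. 1.2 (proof: the span of `GL_k Δ` is a subrepresentation), p.5 (PDF p.6)] -/
theorem le_span_orbit_of_isIrreducible {k d : ℕ}
    (W : Submodule ℂ (MvPolynomial (DegIdx (Fin k) d) ℂ))
    (hW : ∀ g : GL (Fin k) ℂ, W ≤ W.comap (coordRep (Fin k) ℂ d g))
    (hirr : ((coordRep (Fin k) ℂ d).subrepresentation W hW).IsIrreducible)
    {Δ₀ : MvPolynomial (DegIdx (Fin k) d) ℂ} (hΔ₀ : Δ₀ ∈ W) (hΔ₀0 : Δ₀ ≠ 0) :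
    W ≤ Submodule.span ℂ (Set.range fun h : GL (Fin k) ℂ => coordRep (Fin k) ℂ d h Δ₀) := by
  haveI := hirr
  set ρW := (coordRep (Fin k) ℂ d).subrepresentation W hW with hρW
  let K : Subrepresentation ρW :=
    ⟨Submodule.span ℂ (Set.range fun g : GL (Fin k) ℂ => ρW g ⟨Δ₀, hΔ₀⟩),
      fun g y hy => apply_mem_span_orbit ρW _ g hy⟩
  have hmemK : (⟨Δ₀, hΔ₀⟩ : W) ∈ K := by
    change (⟨Δ₀, hΔ₀⟩ : W) ∈ Submodule.span ℂ (Set.range fun g : GL (Fin k) ℂ => ρW g ⟨Δ₀, hΔ₀⟩)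
    exact Submodule.subset_span ⟨1, by
      change ρW 1 ⟨Δ₀, hΔ₀⟩ = ⟨Δ₀, hΔ₀⟩
      rw [map_one, Module.End.one_apply]⟩
  have hK : K = ⊤ := by
    rcases IsSimpleOrder.eq_bot_or_eq_top K with hbot | htop
    · exfalso
      rw [hbot] at hmemK
      have h0 : (⟨Δ₀, hΔ₀⟩ : W) = 0 := hmemK
      exact hΔ₀0 (congrArg Subtype.val h0)
    · exact htop
  intro x hx
  have hxK : (⟨x, hx⟩ : W) ∈ K := by
    rw [hK]
    exact Submodule.mem_top
  have hxK' : (⟨x, hx⟩ : W) ∈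
      Submodule.span ℂ (Set.range fun g : GL (Fin k) ℂ => ρW g ⟨Δ₀, hΔ₀⟩) := hxK
  have hmap := Submodule.mem_map_of_mem (f := W.subtype) hxK'
  rw [Submodule.map_span] at hmap
  refine Submodule.span_mono ?_ hmap
  rintro _ ⟨_, ⟨g, rfl⟩, rfl⟩
  exact ⟨g, rfl⟩

/-- **van den Berg–Dutta–Gesmundo–Ikenmeyer–Lysikov 2024, Corollary 1.2 holds** (absolute
constant `C = 6`): in an irreducible `GL_k`-representation `W` of format-`(δ, d, k)`
metapolynomials whose cheapest nonzero element has `cc = s`, every element has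
`cc ≤ 6 s k^{2k²} (δd)^{2k⁴ + k²}`. Route (disclosed substitution for the printed one via
Thm. 1.1 (4) and Gelfand–Tsetlin patterns): `W` is the span of the orbit of the cheapest element
(irreducibility), which has dimension `≤ (δd+1)^{k²}` (`exists_finset_forall_coordRep_mem_span`);
so every element is a combination of `≤ (δd+1)^{k²}` translates, each of `cc = s` (the sharp
bound `(δd+1)^{k²} (s+2)` is `cor_1_2_sharp`). Discharge of the named fact
`BergEtAl2024.cor_1_2`. [cite: BergEtAl2024, Cor. 1.2, p.5 (PDF p.6)] -/
theorem cor_1_2_holds : cor_1_2 := by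
  refine ⟨6, fun δ d k hd W hW hirr hhom s Δ₀ hΔ₀W hΔ₀0 hs _ Δ hΔW => ?_⟩
  classical
  have hWle := le_span_orbit_of_isIrreducible W hW hirr hΔ₀W hΔ₀0
  have hΔM := hWle hΔW
  have hΔ₀hom : Δ₀.IsHomogeneous δ := hhom Δ₀ hΔ₀W
  by_cases haff : Δ₀.totalDegree ≤ 1
  · rw [affComplexity_eq_zero_of_mem_span_of_totalDegree_le_one
      (totalDegree_le_one_of_mem_range_orbit haff) hΔM]
    exact Nat.zero_le _
  · have hs1 : 1 ≤ s := by
      by_contra h0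
      exact haff (totalDegree_le_one_of_affComplexity_eq_zero (by omega))
    have hδ : 2 ≤ δ := by
      by_contra h
      exact haff (hΔ₀hom.totalDegree_le.trans (by omega))
    refine (affComplexity_le_of_mem_span_orbit hΔ₀hom hs.le hΔM).trans ?_
    refine (orbit_cost_le (D := δ * d) (k := k) (by nlinarith) hs1).trans ?_
    refine Nat.mul_le_mul_left _ (Nat.pow_le_pow_right (by nlinarith) ?_)
    rcases Nat.eq_zero_or_pos k with rfl | hk
    · simp
    · have := Nat.pow_le_pow_right hk (show 3 ≤ 4 by norm_num)
      omega

/-- **Corollary 1.2, sharp form of this route**: `cc(Δ) ≤ (δd + 1)^{k²} (s + 2)` for every `Δ`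
in an irreducible `W` containing a nonzero `Δ₀` of degree `δ` with `cc(Δ₀) ≤ s` (no minimality
needed). [cite: BergEtAl2024, Cor. 1.2, p.5 (PDF p.6)] -/
theorem cor_1_2_sharp {δ d k s : ℕ} (W : Submodule ℂ (MvPolynomial (DegIdx (Fin k) d) ℂ))
    (hW : ∀ g : GL (Fin k) ℂ, W ≤ W.comap (coordRep (Fin k) ℂ d g))
    (hirr : ((coordRep (Fin k) ℂ d).subrepresentation W hW).IsIrreducible)
    {Δ₀ : MvPolynomial (DegIdx (Fin k) d) ℂ} (hΔ₀ : Δ₀ ∈ W) (hΔ₀0 : Δ₀ ≠ 0)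
    (hhom : Δ₀.IsHomogeneous δ) (hs : affComplexity Δ₀ ≤ s)
    {Δ : MvPolynomial (DegIdx (Fin k) d) ℂ} (hΔ : Δ ∈ W) :
    affComplexity Δ ≤ (δ * d + 1) ^ (k * k) * (s + 2) :=
  affComplexity_le_of_mem_span_orbit hhom hs
    (le_span_orbit_of_isIrreducible W hW hirr hΔ₀ hΔ₀0 hΔ)

end BergEtAl2024

end Literature.Barriers.ValiantsHypothesis

end
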